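import Mathlib
import HarnessLib
import Summits.HubbardSuperconductivity.HubbardSuperconductivity.Theorems.KLProgrammeKLRegimeEngineV8TwoLegMomentsExport

/-!
# Route `KLProgramme` — ENGINE child gen 8 (stmt-HubbardSuperconductivity-20437 `KLRegimeEngineV17F2`), SKELETON v2, CLASS #7 sequel: the two-leg moments atom
# with RAW budgets and the FIT-FORM consumer of stub (e) — LAW-AGNOSTIC (cell gate-hubbard-kl, seat hubbard-kl-r2d-p1 g7, class-#7 text owner)

Sequel of `…EngineV8TwoLegMomentsExport` (§1–§4 there: the atom `TwoLegMomentsAt … Zt Zs …` at the law `Mt := Zt·U²`, the export `TwoLegDualMomentsAt`, the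
consumers in allowance / generic-threshold form, the step Prop and the deferred package).  KL STATUS 2026-08-27 ≈16:48Z (k3c3-p2 g8, «(c-D)-LIMITS»): the
tower's weighted data at internal levels may carry a level excess `1 + C|U|^{−1/4}·2^{−3j/2}`, so the m = 2 first-moment line need not come in the law `Zt·U²`
with `U`-free `Zt`.  Stub (e) does not care: its row B needs only the two FIT lines `2·Mt ≤ cz|U|` and `2·Ms + (4/3)Gfr₁U² ≤ cz|U|·cDtmin(−1.2,−0.05)/2`
(`twoLegStepV17F2_of_jets_sepTubeGradient_nestedLegs_pkg`'s `hz`/`hfit1`).  So: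

* §1 **`TwoLegMomentBoundsAt L M Mt Ms β U μ K n`** — the atom with RAW budgets (LITERALLY the `hMt`/`hMs` rows of `stub_twoLeg_step_of_dualMoments_GQ`);
  `twoLegMomentsAt_iff_bounds` (§1 of the parent IS this atom at `Mt := Zt·U²`, `Ms := Zs·U²`, `Iff.rfl`), `.mono`, `.toMomentsAt`, `TwoLegMomentsAt.toBounds`;
* §2 `twoLeg_slopeSizes_of_twoLegMomentBoundsAt` (any `K`, `n`: `|z − 1| ≤ 2Mt`, separated tube gradient `≤ 2Ms`) and
  **`stub_twoLeg_step_of_twoLegMomentBounds_fits_GQJ`** — stub (e)'s literal binders at `(G, Q, cJ, cJ')` (doors `klEngC₃3`, `klEngU₀4` only) +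
  `hD : TwoLegMomentBoundsAt L M Mt Ms β U μ (K_n) n` + the two FIT lines as hypotheses (whatever law and door produced them) + C1/C2 ⇒ `TwoLegStepV17F2 … n`.

The producer (stub (b) v2, if class #7 is bought on 08-29) picks the law — `C·U²` (BGM 2006 (2.36): first-derivative increments `C₁U²|h|γ^h`, summable),
`C·U²(1 + C′|U|^{−1/4})` ((c-D) excess), or `C·U² + C′|U|³n` (a gainless third-order class, paid through the `c`-door) — and the step Prop / deferred package of
the parent is re-cut to it in one pass.  One definition with body + proofs; nothing about the model is asserted; nothing asserts superconductivity.
References: BGM 2006 §2.1 (2.4)–(2.5), §2.4 (2.36) [cite: BenfattoGiulianiMastropietro2006].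
-/

noncomputable section

namespace Summit.HubbardSuperconductivity.HubbardSuperconductivity.Theorems.KLRegimeSplit

set_option linter.dupNamespace false -- summit = problem name (single-conjunct summit), D-0017

open Finset Complex
open Literature.MathematicalPhysics.QuantumLattice Literature.Probability.LatticeModels GrassmannAlgebra
open Literature.MathematicalPhysics.QuantumLattice.BandSectorCounting
open Summit.HubbardSuperconductivity.HubbardSuperconductivity.Theorems.KLProgrammeLegKernels

/-! ## §1 The atom with raw budgets -/

section RawModel

variable (L M : ℕ) [NeZero L]

/-- **`TwoLegMomentBoundsAt L M Mt Ms β U μ K n`** — the two-leg moments atom with RAW budgets: the circular time first moment `≤ Mt` and the off-diagonal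
first space moment `≤ Ms` of the trivial-multiplier position-space two-leg kernel of `klEffectiveAction … K klE0 n − counterQuadratic … K`, for both spins and
every pin (LITERALLY the `hMt`/`hMs` rows of `stub_twoLeg_step_of_dualMoments_GQ`). -/
def TwoLegMomentBoundsAt (Mt Ms : ℝ) (β U μ : ℝ) (K : TrigPolyC4v) (n : ℕ) : Prop :=
  (∀ (σ : Fin 2) (x₀ : SpaceTimeIdx L M), imagTimeWeight β M *
      ∑ x ∈ (univ : Finset (Fin 2 → SpaceTimeIdx L M)).filter (fun x => x 0 = x₀),
        imagTimeWeight β M * (circDist (2 * M) (x 0).1.val (x 1).1.val : ℝ) *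
          ‖sectorisedKernel L M β (trivialMultiplier L M) (klEffectiveAction L M β U μ K klE0 n - counterQuadratic L M β K) 2
            (![((0, σ), 0), ((0, σ), 1)] : Fin 2 → SectorLeg 1) x‖ ≤ Mt) ∧
  (∀ (σ : Fin 2) (x₀ : SpaceTimeIdx L M), imagTimeWeight β M *
      ∑ x ∈ (univ : Finset (Fin 2 → SpaceTimeIdx L M)).filter (fun x => x 0 = x₀ ∧ (x 1).2 ≠ (x 0).2),
        (1 + ((((x 1).2 - (x 0).2) 0).valMinAbs.natAbs : ℝ) + ((((x 1).2 - (x 0).2) 1).valMinAbs.natAbs : ℝ)) ^ 1 *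
          ‖sectorisedKernel L M β (trivialMultiplier L M) (klEffectiveAction L M β U μ K klE0 n - counterQuadratic L M β K) 2
            (![((0, σ), 0), ((0, σ), 1)] : Fin 2 → SectorLeg 1) x‖ ≤ Ms)

variable {L M}

/-- The parent's §1 atom IS the raw atom at the law `Mt := Zt·U²`, `Ms := Zs·U²`. -/
theorem twoLegMomentsAt_iff_bounds (Zt Zs β U μ : ℝ) (K : TrigPolyC4v) (n : ℕ) :
    TwoLegMomentsAt L M Zt Zs β U μ K n ↔ TwoLegMomentBoundsAt L M (Zt * U ^ 2) (Zs * U ^ 2) β U μ K n := Iff.rfl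

/-- Budget monotonicity of the raw atom. -/
theorem TwoLegMomentBoundsAt.mono {Mt Ms Mt' Ms' β U μ : ℝ} {K : TrigPolyC4v} {n : ℕ} (h : TwoLegMomentBoundsAt L M Mt Ms β U μ K n)
    (ht : Mt ≤ Mt') (hs : Ms ≤ Ms') : TwoLegMomentBoundsAt L M Mt' Ms' β U μ K n :=
  ⟨fun σ x₀ => (h.1 σ x₀).trans ht, fun σ x₀ => (h.2 σ x₀).trans hs⟩

/-- From raw budgets below a `U²` law to the parent's §1 atom. -/
theorem TwoLegMomentBoundsAt.toMomentsAt {Mt Ms Zt Zs β U μ : ℝ} {K : TrigPolyC4v} {n : ℕ} (h : TwoLegMomentBoundsAt L M Mt Ms β U μ K n)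
    (ht : Mt ≤ Zt * U ^ 2) (hs : Ms ≤ Zs * U ^ 2) : TwoLegMomentsAt L M Zt Zs β U μ K n :=
  (twoLegMomentsAt_iff_bounds Zt Zs β U μ K n).2 (h.mono ht hs)

/-- The parent's §1 atom gives the raw atom at its law. -/
theorem TwoLegMomentsAt.toBounds {Zt Zs β U μ : ℝ} {K : TrigPolyC4v} {n : ℕ} (h : TwoLegMomentsAt L M Zt Zs β U μ K n) :
    TwoLegMomentBoundsAt L M (Zt * U ^ 2) (Zs * U ^ 2) β U μ K n :=
  (twoLegMomentsAt_iff_bounds Zt Zs β U μ K n).1 h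

end RawModel

end Summit.HubbardSuperconductivity.HubbardSuperconductivity.Theorems.KLRegimeSplit

namespace Summit.HubbardSuperconductivity.HubbardSuperconductivity.Theorems.EngineV8

set_option linter.dupNamespace false -- summit = problem name (single-conjunct summit), D-0017

open Real Finset Literature.MathematicalPhysics.QuantumLattice Literature.Probability.LatticeModels GrassmannAlgebra
open Literature.MathematicalPhysics.QuantumLattice.FermiRG Literature.MathematicalPhysics.QuantumLattice.BandSectorCounting
open Summit.HubbardSuperconductivity.HubbardSuperconductivity.Theorems.KLProgrammeLegKernels
open Summit.HubbardSuperconductivity.HubbardSuperconductivity.Theorems.DispersionFlow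
open Summit.HubbardSuperconductivity.HubbardSuperconductivity.Theorems.PerturbedFermiCurve
open Summit.HubbardSuperconductivity.HubbardSuperconductivity.Theorems.KLRegimeSplit
open Summit.HubbardSuperconductivity.HubbardSuperconductivity.Theorems.TwoPointAssembly
open Summit.HubbardSuperconductivity.HubbardSuperconductivity.Theorems.TwoLegFourier

/-! ## §2 Consumers -/

/-- **THE TWO SLOPE SIZES FROM THE RAW ATOM, every frame, every scale** (`0 < β`): `|klFieldStrength … K n k − 1| ≤ 2·Mt` at every torus momentum and the
separated tube gradient `≤ 2·Ms` at every `q`. -/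
theorem twoLeg_slopeSizes_of_twoLegMomentBoundsAt {L M : ℕ} [NeZero L] [NeZero M] {β : ℝ} (hβ : 0 < β) {U μ : ℝ} {K : TrigPolyC4v} {n : ℕ}
    {Mt Ms : ℝ} (h : TwoLegMomentBoundsAt L M Mt Ms β U μ K n) :
    (∀ k : TorusSite 2 L, |klFieldStrength L M β U μ K n k - 1| ≤ 2 * Mt) ∧
    ∀ q : Momentum, ‖fderiv ℝ
      (evalM (symInterp L (fun p => klLocSelfEnergyRe L M β U μ K n p - K.eval (latticeMomentum L p)))) q‖ ≤ 2 * Ms :=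
  ⟨fun k => abs_klFieldStrength_sub_one_le_of_dual_time_moment_sub_counter hβ U μ K n k h.1,
    fun q => twoLeg_sep_fderiv_of_dual_offDiag_moment hβ U μ K n h.2 q⟩

/-- **STUB (e) OF 20437 MODULO RAW TWO-LEG MOMENT BUDGETS AND THE TWO FIT LINES — law-agnostic, package `(G, Q)`, thresholds AND jet tables as binders.**
Doors `c₃ ≤ klEngC₃3 P R`, `U₀c ≤ klEngU₀4 P R c` only; the stub's literal binders at `(G, Q)` with `hJ : TwoLegReadJetBound L M cJ cJ' …`; then
`hD : TwoLegMomentBoundsAt L M Mt Ms β U μ (K_n) n`, the two FIT lines `hzfit : 2·Mt ≤ cz·|U|`, `hsfit : 2·Ms + (4/3)·Gfr₁·U² ≤ cz·|U|·(cDtmin(−1.2)(−0.05)/2)`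
(whatever law and door produced them), and C1 `hcut`, C2 `hsp` ⇒ `TwoLegStepV17F2 L M G P Q R β U μ n`. -/
theorem stub_twoLeg_step_of_twoLegMomentBounds_fits_GQJ (G : GeoConsts) (Q : EngConsts) (cJ cJ' : ℕ → ℝ) {c₃ U₀c : ℝ} (P : SplitConsts)
    (R : RenConsts) (c : ℝ) {Mt Ms : ℝ}
    (hGS : ∀ k, cJ k ≤ G.S k) (hQS : ∀ k, cJ' k ≤ Q.S' k) (hQCL : ∀ (β : ℝ) (n : ℕ), 0 ≤ Q.CL β n)
    (hc₃ : c₃ ≤ klEngC₃3 P R) (hU₀ : U₀c ≤ klEngU₀4 P R c) (hP : P.WF) (hR : R.WF2) (hc : 0 < c) (hc3 : c ≤ c₃)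
    (μ : ℝ) (hμ : μ ∈ klWindowC) (U : ℝ) (hU : 0 < U) (hUle : U ≤ U₀c) (β : ℝ) (hβ : klBetaMin ≤ β) (hβc : β ≤ Real.exp (c / U ^ 2))
    (L M : ℕ) [NeZero L] [NeZero M] (hL : klEngL₃ β U ≤ L) (hM : klEngM₃ β U L ≤ M)
    (n : ℕ) (hn1 : 1 ≤ n) (hn : n ≤ nScales β + 1) (hreg : IsKLRegime U c (-(n : ℤ)))
    (hhist : HistP klPredsV17F2 L M G P Q R β U μ 0 n)
    (hfr : FrameOK R U (nScales β) μ (klFlowFrameU L M β U μ n))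
    (hE : EngineBoundsAtV17F2 L M G P Q β U μ n)
    (hJ : TwoLegReadJetBound L M cJ cJ' β U μ (klFlowFrameU L M β U μ n) n)
    (hD : TwoLegMomentBoundsAt L M Mt Ms β U μ (klFlowFrameU L M β U μ n) n)
    (hzfit : 2 * Mt ≤ R.cz * |U|) (hsfit : 2 * Ms + 4 / 3 * R.Gfr 1 * U ^ 2 ≤ R.cz * |U| * (cDtmin (-1.2) (-0.05) / 2))
    (hcut : ∀ (Mq : ℕ → ℕ) (L₁ M₁ M₂ : ℕ) [NeZero L₁] [NeZero M₁] [NeZero M₂], L ≤ L₁ → Q.M0 β L₁ ≤ M₁ → Mq L₁ ≤ M₁ → M₁ ≤ M₂ →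
      (∀ j < n, histV17F2 L₁ M₁ G P Q R β U μ j ∧ TwoLegSlopes L₁ M₁ R β U μ (klFlowFrameU L₁ M₁ β U μ j) j) →
      (∀ j < n, histV17F2 L₁ M₂ G P Q R β U μ j ∧ TwoLegSlopes L₁ M₂ R β U μ (klFlowFrameU L₁ M₂ β U μ j) j) →
        ∀ θ : ℝ, |klLocalPart L₁ M₁ β U μ (klFlowFrameU L₁ M₁ β U μ n) n θ -
          klLocalPart L₁ M₂ β U μ (klFlowFrameU L₁ M₂ β U μ n) n θ| ≤ Q.CL β n / 4 / L₁)
    (hsp : ∀ (Mq : ℕ → ℕ) (L₁ L₂ M₂ : ℕ) [NeZero L₁] [NeZero L₂] [NeZero M₂], L ≤ L₁ → L₁ ∣ L₂ → Q.M0 β L₁ ≤ M₂ → Mq L₁ ≤ M₂ →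
      Q.M0 β L₂ ≤ M₂ → Mq L₂ ≤ M₂ →
      (∀ j < n, histV17F2 L₁ M₂ G P Q R β U μ j ∧ TwoLegSlopes L₁ M₂ R β U μ (klFlowFrameU L₁ M₂ β U μ j) j) →
      (∀ j < n, histV17F2 L₂ M₂ G P Q R β U μ j ∧ TwoLegSlopes L₂ M₂ R β U μ (klFlowFrameU L₂ M₂ β U μ j) j) →
        ∀ θ : ℝ, |klLocalPart L₁ M₂ β U μ (klFlowFrameU L₁ M₂ β U μ n) n θ -
          klLocalPart L₂ M₂ β U μ (klFlowFrameU L₂ M₂ β U μ n) n θ| ≤ Q.CL β n / 4 / L₁) :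
    TwoLegStepV17F2 L M G P Q R β U μ n := by
  have _ := hP; have _ := hM; have _ := hn1; have _ := hreg; have _ := hhist; have _ := hE
  have hβ0 : 0 < β := lt_of_lt_of_le (by norm_num [klBetaMin]) hβ
  obtain ⟨hzt, hms⟩ := twoLeg_slopeSizes_of_twoLegMomentBoundsAt hβ0 hD
  have hz : ∀ k ∈ klShell L μ (klFlowFrameU L M β U μ n) n,
      |klFieldStrength L M β U μ (klFlowFrameU L M β U μ n) n k - 1| ≤ R.cz * |U| := fun k _ => (hzt k).trans hzfit
  have hm : ∀ q : Momentum, |frameLevel μ (klFlowFrameU L M β U μ n) q| ≤ klScale klE0 n →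
      ‖fderiv ℝ (evalM (symInterp L (fun p => klLocSelfEnergyRe L M β U μ (klFlowFrameU L M β U μ n) n p -
        (klFlowFrameU L M β U μ n).eval (latticeMomentum L p)))) q‖ ≤ 2 * Ms := fun q _ => hms q
  exact twoLegStepV17F2_of_jets_sepTubeGradient_nestedLegs_pkg G Q P hR hc (hc3.trans hc₃) hμ hU (hUle.trans hU₀) hβ hβc hL hn hfr (hQCL β n)
    hGS hQS hJ.1 hJ.2 hz hm hsfit hcut hsp

end Summit.HubbardSuperconductivity.HubbardSuperconductivity.Theorems.EngineV8

end
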